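/-
Copyright (c) 2026 the pub-hodgecm-mathlib formalisation cell (harness21).  Prover seat hodgecm-mathlib-F0P3a-p09 (g14) (G-row reader ∕ dealer, LEAD F0P3a-plan T15-17);
the PLACE JUNCTION of ★ (G3) `F0P3cStCharTSEPGlueG` (LH10-p02 (g12), unramified) and ★ (G3)-RAM `F0P3cStCharTSEPGlueGRamified` (LH5-p04 (g9), tame ramified); 2026-09-03.
-/
import Summits.HodgeConjecture.HodgeConjecture.Theorems.F0P3cStCharTSEPGlueGRamified            -- ★ (G3)-RAM FILE B (LH5-p04): `exists_epFunction_G_of_ramified`; brings ★ (G3) `exists_epFunction_G` and FILE A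
import Literature.NumberTheory.Automorphic.Liu2021.LemD1AsPrintedIndexedNonVacuityTameSynthesis  -- ★ `isUnramifiedIn_of_ramificationIdx'_eq_one` (at a non-split place `e(w|v) = 1 ⇒ IsUnramifiedIn`)
import Literature.NumberTheory.Rogawski1990.ValuedTwoPlacesOver                                  -- ★ `valued_two_eq_one_iff_of_placesOver` (`|2|_w = 1 ↔ |2|_v = 1`)
import HarnessLib

/-!
# F0 · P3c · line LH6 «StCharTS» — «(G3)-NOT-WILD»: KOTTWITZ'S EULER–POINCARÉ FUNCTION ON `G_v = U(Φ₃)(L⁺_v)` AT EVERY NON-SPLIT PLACE THAT IS NOT WILDLY RAMIFIED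
# [Kottwitz1988 §2 Thm. 2; Rogawski1990 §12.6 p. 187; Tits1979 §2.4]

Cell `pub/hodgecm-mathlib`, crux H413 = `stmt-HodgeConjecture-24833` (lane `--kind proof --supports … --as helper`), route HCCMUnconditional; seat F0P3a-p09 (g14).
THEOREMS ONLY (no definition ∕ instance ∕ notation ∕ named fact ∕ `sorry`); ★-only imports.

WHAT.  The place junction the RIDER after 2a «EP-SPLIT» cites ONCE (LEAD F0P3a-plan (g16) 2026-09-03T00:06:42Z: the `Algebra.IsUnramifiedIn` conjunct of the 2a guard «is
dropped by the NEXT rider … WILD stays in the guard until census G-RAM §4 closes»): for a CM field `L`, a finite place `v` of `L⁺` that is NON-SPLIT in `L` and either UNRAMIFIED in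
`L` or of ODD residue characteristic (`|2|_v = 1`) — i.e. every non-split place except the wildly ramified (dyadic ramified) ones — Kottwitz's Euler–Poincaré function `f_G` on
`G_v = U(Φ₃)(L⁺_v)` exists with the EIGHT clauses of ★ (G3) `exists_epFunction_G` VERBATIM (locally constant compactly supported, measurable, integrable, mass one, `f_G(1)` real
negative, canonical orbital integral `1` at regular classes with compact centraliser and `0` at regular classes with non-compact centraliser).

HOW.  Pure case split, no new mathematics: `IsUnramifiedIn` ⇒ ★ (G3) `exists_epFunction_G`; otherwise pick the (unique, ★ `hns`) place `w ∣ v`; if `e(w|v) = 1` then `v` is unramified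
in `L` (★ `Liu2021.….isUnramifiedIn_of_ramificationIdx'_eq_one`, Neukirch I (8.2)) ⇒ ★ (G3) again; if `e(w|v) ≠ 1` then `|2|_w = 1` (★ `Rogawski1990.valued_two_eq_one_iff_of_placesOver`) ⇒
★ (G3)-RAM `exists_epFunction_G_of_ramified`.

* §1 **`exists_epFunction_G_of_ramificationIdx'_or_valued_two`** — the junction with the place `w` as a binder: `e(w|v) = 1 ∨ |2|_w = 1`.
* §2 **`exists_epFunction_G_of_not_wild`** — the junction in `L⁺_v`-letters: `Algebra.IsUnramifiedIn (𝓞 L) 𝔭_v ∨ |2|_v = 1`.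
HONEST LABEL: count-neutral helper (UNPROVED 16 unchanged; it lets a rider shrink the EP-family GUARD from «unramified» to «not wildly ramified», it closes no node; WILD∕dyadic
ramified places stay OPEN, census G-RAM §4); h413 OPEN; HC_CM is proved only modulo the 7 printed citations (2 remaining named inputs: hLiu418 = `stmt-HodgeConjecture-24832`,
h413 = `stmt-HodgeConjecture-24833`) until rung 0 closes.

## References
* [Kottwitz1988] R. E. Kottwitz, *Tamagawa numbers*, Ann. of Math. 127 (1988), §2 Theorem 2 (Euler–Poincaré functions on a rank-one group).
* [Rogawski1990] J. D. Rogawski, *Automorphic Representations of Unitary Groups in Three Variables* (1990), §12.6 p. 187 (pseudo-coefficients).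
* [Tits1979] J. Tits, *Reductive groups over local fields*, PSPM 33.1 (1979), §2.4 (local indices of `²A₂`: `(q³+1, q+1)` unramified, `(q+1, q+1)` ramified).
* [NeukirchANT1999] J. Neukirch, *Algebraic Number Theory* (1999), Ch. I §8 Prop. (8.2), Ch. II §4 Prop. (4.3).
-/

set_option autoImplicit false
-- the mandated namespace has the single-problem summit's repeated segment (`HodgeConjecture.HodgeConjecture`)
set_option linter.dupNamespace false

noncomputable section

open NumberField IsDedekindDomain MeasureTheory Topology
open scoped Matrix MatrixGroups Valued
open Literature.NumberTheory.Rogawski1990 Literature.NumberTheory.Automorphic Literature.NumberTheory.Automorphic.UnitaryGroup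
open Literature.NumberTheory.GaloisRepresentations
open Literature.NumberTheory.Automorphic.Liu2021.LemD1IndexedNonVacuityTameSynthesis (isUnramifiedIn_of_ramificationIdx'_eq_one)
open Summit.HodgeConjecture.HodgeConjecture.Cruxes.H413.F0P3cStCharTSEPGlueG
open Summit.HodgeConjecture.HodgeConjecture.Cruxes.H413.F0P3cStCharTSEPGlueGRamified

namespace Summit.HodgeConjecture.HodgeConjecture.Cruxes.H413.F0P3cStCharTSEPGlueGNotWild

variable (L : Type) [Field L] [NumberField L] [IsCMField L] (v : HeightOneSpectrum (𝓞 ↥(maximalRealSubfield L)))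

/-! ## §1 The junction with the place `w ∣ v` as a binder -/

set_option maxHeartbeats 1600000 in  -- statement-level `whnf` on the CM carriers + eight clauses, exactly as ★ (G3) `exists_epFunction_G` :152 and ★ (G3)-RAM FILE B (measured there)
/-- **(G3) AT `w ∣ v` WITH `e(w|v) = 1 ∨ |2|_w = 1`**: Kottwitz's Euler–Poincaré function on `G_v = U(Φ₃)(L⁺_v)` (`v` non-split) exists — the eight clauses of ★ (G3)
`exists_epFunction_G` VERBATIM — whenever the place `w` of `L` above `v` is unramified over `v` OR has odd residue characteristic.  Case split: `e(w|v) = 1` ⇒ `v` unramified in `L`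
(★ `isUnramifiedIn_of_ramificationIdx'_eq_one`, the non-split place `w` is the only one above `v`) ⇒ ★ (G3); `e(w|v) ≠ 1` and `|2|_w = 1` ⇒ ★ (G3)-RAM `exists_epFunction_G_of_ramified`.
[cite: Kottwitz1988, §2 Theorem 2] [cite: Rogawski1990, §12.6 p. 187] [cite: Tits1979, §2.4] -/
theorem exists_epFunction_G_of_ramificationIdx'_or_valued_two (hns : ∀ w : PlacesOver L v, IsCMField.complexConj L • w.1 = w.1)
    (w : PlacesOver L v) (hw2 : v.asIdeal.ramificationIdx' w.1.asIdeal = 1 ∨ Valued.v (2 : w.1.adicCompletion L) = 1)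
    [MeasurableSpace (Gqs L v)] [BorelSpace (Gqs L v)]
    [∀ γ : Gqs L v, MeasurableSpace (Gqs L v ⧸ Subgroup.centralizer ({γ} : Set (Gqs L v)))]
    [∀ γ : Gqs L v, BorelSpace (Gqs L v ⧸ Subgroup.centralizer ({γ} : Set (Gqs L v)))]
    (νQv : Measure (Gqs L v)) [νQv.IsHaarMeasure] [νQv.IsMulRightInvariant]
    {mQv : OrbitalMeasureFamily (Gqs L v)}
    (hcanQ : mQv.IsCanonical (fun γ => IsRegularElt (γ.val : GL (Fin 3) (UnitaryGroup.LocalRing L v))) νQv) :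
    ∃ fG : Gqs L v → ℂ, IsLocSmooth fG ∧ Measurable fG ∧ Integrable fG νQv ∧ ∫ g, fG g ∂νQv = 1 ∧
      (fG 1).im = 0 ∧ (fG 1).re < 0 ∧
      (∀ γ : Gqs L v, IsRegularElt (γ.val : GL (Fin 3) (UnitaryGroup.LocalRing L v)) →
        IsCompact ((Subgroup.centralizer ({γ} : Set (Gqs L v))) : Set (Gqs L v)) → classOrbitalIntegral mQv fG (ConjClasses.mk γ) = 1) ∧
      (∀ γ : Gqs L v, IsRegularElt (γ.val : GL (Fin 3) (UnitaryGroup.LocalRing L v)) →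
        ¬ IsCompact ((Subgroup.centralizer ({γ} : Set (Gqs L v))) : Set (Gqs L v)) → classOrbitalIntegral mQv fG (ConjClasses.mk γ) = 0) := by
  by_cases he : v.asIdeal.ramificationIdx' w.1.asIdeal = 1
  · haveI : Algebra.IsQuadraticExtension ↥(maximalRealSubfield L) L := IsCMField.isQuadraticExtension L
    exact exists_epFunction_G L v hns
      (isUnramifiedIn_of_ramificationIdx'_eq_one L (IsCMField.complexConj L) v (IsCMField.complexConj_ne_one L) w (hns w) he) νQv hcanQ
  · exact exists_epFunction_G_of_ramified L v hns w he (hw2.resolve_left he) νQv hcanQ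

/-! ## §2 The junction in `L⁺_v`-letters: unramified in `L` OR odd residue characteristic -/

set_option maxHeartbeats 1600000 in  -- statement-level `whnf` on the CM carriers + eight clauses, exactly as ★ (G3) `exists_epFunction_G` :152 (measured there)
/-- **(G3)-NOT-WILD — KOTTWITZ'S EULER–POINCARÉ FUNCTION ON `G_v = U(Φ₃)(L⁺_v)` AT EVERY NON-SPLIT PLACE THAT IS NOT WILDLY RAMIFIED** (`v` unramified in `L` OR `|2|_v = 1`):
there is `f_G : G_v → ℂ`, locally constant with compact support, measurable, integrable, with `∫ f_G dνQv = 1`, `f_G(1)` REAL NEGATIVE, canonical orbital integral `1` at every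
regular class with COMPACT centraliser and `0` at every regular class with NON-compact centraliser — the eight clauses of ★ (G3) `exists_epFunction_G` VERBATIM, so every (G3)
consumer ((G4) ELL-MASS-G, (G5) pseudo-coefficients, RIDER 2a's junction) `obtain`s it unchanged.  The one name a rider cites to shrink the EP-family guard from «`v` unramified in `L`»
to «`v` not wildly ramified in `L`»; the wildly ramified (dyadic ramified) places remain OPEN (census G-RAM §4).
[cite: Kottwitz1988, §2 Theorem 2] [cite: Rogawski1990, §12.6 p. 187] [cite: Tits1979, §2.4] -/
theorem exists_epFunction_G_of_not_wild (hns : ∀ w : PlacesOver L v, IsCMField.complexConj L • w.1 = w.1)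
    (hv : Algebra.IsUnramifiedIn (𝓞 L) v.asIdeal ∨ Valued.v (2 : v.adicCompletion ↥(maximalRealSubfield L)) = 1)
    [MeasurableSpace (Gqs L v)] [BorelSpace (Gqs L v)]
    [∀ γ : Gqs L v, MeasurableSpace (Gqs L v ⧸ Subgroup.centralizer ({γ} : Set (Gqs L v)))]
    [∀ γ : Gqs L v, BorelSpace (Gqs L v ⧸ Subgroup.centralizer ({γ} : Set (Gqs L v)))]
    (νQv : Measure (Gqs L v)) [νQv.IsHaarMeasure] [νQv.IsMulRightInvariant]
    {mQv : OrbitalMeasureFamily (Gqs L v)}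
    (hcanQ : mQv.IsCanonical (fun γ => IsRegularElt (γ.val : GL (Fin 3) (UnitaryGroup.LocalRing L v))) νQv) :
    ∃ fG : Gqs L v → ℂ, IsLocSmooth fG ∧ Measurable fG ∧ Integrable fG νQv ∧ ∫ g, fG g ∂νQv = 1 ∧
      (fG 1).im = 0 ∧ (fG 1).re < 0 ∧
      (∀ γ : Gqs L v, IsRegularElt (γ.val : GL (Fin 3) (UnitaryGroup.LocalRing L v)) →
        IsCompact ((Subgroup.centralizer ({γ} : Set (Gqs L v))) : Set (Gqs L v)) → classOrbitalIntegral mQv fG (ConjClasses.mk γ) = 1) ∧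
      (∀ γ : Gqs L v, IsRegularElt (γ.val : GL (Fin 3) (UnitaryGroup.LocalRing L v)) →
        ¬ IsCompact ((Subgroup.centralizer ({γ} : Set (Gqs L v))) : Set (Gqs L v)) → classOrbitalIntegral mQv fG (ConjClasses.mk γ) = 0) := by
  rcases hv with hunr | h2
  · exact exists_epFunction_G L v hns hunr νQv hcanQ
  · obtain ⟨w⟩ : Nonempty (PlacesOver L v) := inferInstance
    exact exists_epFunction_G_of_ramificationIdx'_or_valued_two L v hns w
      (Or.inr ((valued_two_eq_one_iff_of_placesOver L w).2 h2)) νQv hcanQ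

end Summit.HodgeConjecture.HodgeConjecture.Cruxes.H413.F0P3cStCharTSEPGlueGNotWild

end
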